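import Mathlib.Algebra.MvPolynomial.PDeriv
import Mathlib.RingTheory.MvPolynomial.Ideal
import Mathlib.RingTheory.Ideal.Quotient.Operations
import Literature.AlgebraicGeometry.Resolution.NeronPopescuLocalTricks
import Literature.AlgebraicGeometry.Resolution.NeronPopescuSingularIdeal
import Literature.AlgebraicGeometry.Resolution.NeronPopescuDesingularizationLemma
import HarnessLib

/-!
# Stacks 07CP (the lifting lemma), general case — II. The algebra `D`

Topic: `Literature/AlgebraicGeometry/Resolution`. The Stacks Project, *Smoothing Ring Maps*
(Tag 07BW), Lemma 07CP, the algebra of the printed proof and its two smoothness properties, for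
ABSTRACT data: polynomials `f_j ∈ R[x_1, …, x_n]` (`j ∈ J`), charts `k = 1, …, r` with
`E_k = ι_k(Fin c_k) ⊆ J`, `a_k, h^j_{k,ℓ}, g_{k,ℓ} ∈ R[x]` subject to the relations
(4) `a_k f_ℓ = ∑_{j ∈ E_k} h^j_{k,ℓ} f_j + π² g_{k,ℓ}` (normalised: `h^j_{k,ℓ} = a_k δ_{ℓ j}`,
`g_{k,ℓ} = 0` for `ℓ ∈ E_k`) and (5) `a_k^N (a_{k'} h^j_{k,ℓ} - ∑ h^{j'}_{k',ℓ} h^j_{k,j'}) ∈ (f)`.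
> Set `D = R[x_1, …, x_n, z_1, …, z_m]/(f_j - π z_j, p_{k,ℓ})`,
> `p_{k,ℓ} = a_k z_ℓ - ∑_{j ∈ E_k} h^j_{k,ℓ} z_j - π g_{k,ℓ}` … Define `D → Λ` by `x_i ↦ λ_i` and
> `z_j ↦ π μ_j` … The map `C̄ → D/πD` is determined by `x_i ↦ x_i` … the key equality
> `π p_{k,ℓ} = -a_k (f_ℓ - π z_ℓ) + ∑ h^j_{k,ℓ} (f_j - π z_j)` … `D[1/π] ≅ R[1/π][x_1, …, x_n]`
> hence smooth over `R`. This proves (b). For fixed `k` consider the ring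
> `D_k = R[x, z]/(f_j - π z_j, j ∈ E_k, p_{k,ℓ})` … `D_𝔮 = (D_k)_{𝔮_k}` and we win.
Contents: `Dalg` (= `D`), `toΛ` (= `D → Λ`, well defined by (4) and `Ann_Λ(π) = Ann_Λ(π²)`),
`eps` (= `C̄ → D/πD`), `C_mul_relP` (the key equality), `formallySmooth_Dπ` and
`algebraMap_pi_mem_singularIdeal` ((b): `D_π` is a retract of `R_π[x]`, so `π ∈ H_{D/R}`),
the algebras `DK` (= `D_k`) with their naive pre-submersive presentations `preK` and the block
computation of their Jacobians (`det_jacobiMatrix_preK`: `det = det(∂f_j/∂x_{p i}) · a_k^{m-|E_k|}`),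
standard smoothness of `T_k = (D_k)_{det · a_k}` (`isStandardSmooth_TK`) — this explicit Jacobian
REPLACES the printed "`R → D_k` is syntomic with smooth fibre at `𝔮_k`, hence smooth" —, the
vanishing of all relations of `D` in `T_k` (`algebraMap_mkK_relF`, `algebraMap_mkK_relP`: the
printed `a_k^{N+1} p_{k',ℓ} ∈ (I_k, π)`, `π p_{k',ℓ} = 0`, flatness and `Ann_R(π) = Ann_R(π²)`),
the retraction `D_{s_k} → T_k → D_{s_k}` and finally `minor_mul_pow_mem_singularIdeal`:
`det(∂f_{ι_k j}/∂x_{p i}) · a_k^{m-|E_k|+1} ∈ H_{D/R}` (the chartwise content of (c)).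
The assembly with actual charts is `NeronPopescuLiftingGeneral.lean`. No named facts.

## References

* The Stacks Project, *Smoothing Ring Maps* (Tag 07BW), Lemma 07CP and its proof; Algebra,
  Lemma 07DQ. [StacksProject]
-/

noncomputable section

open MvPolynomial

namespace Literature.AlgebraicGeometry.Resolution

namespace Stacks07CPGen

universe u

section Algebra

variable {R : Type u} [CommRing R] (π : R) {n : ℕ} {J : Type}
  (F : J → MvPolynomial (Fin n) R) {r : ℕ} {c : Fin r → ℕ} (ι : ∀ k, Fin (c k) → J)
  (ak : Fin r → MvPolynomial (Fin n) R)
  (h : ∀ k : Fin r, J → Fin (c k) → MvPolynomial (Fin n) R)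
  (g : Fin r → J → MvPolynomial (Fin n) R)

/-- Variables of `R[x, z]`: `x_i = X (inl i)`, `z_j = X (inr j)`. [cite: StacksProject, Tag 07CP] -/
abbrev W (n : ℕ) (J : Type) : Type := Fin n ⊕ J

/-- `R[x] → R[x, z]`. [folklore] -/
abbrev inc : MvPolynomial (Fin n) R →ₐ[R] MvPolynomial (W n J) R := rename Sum.inl

/-- The relation `f_j - π z_j`. [cite: StacksProject, Tag 07CP] -/
def relF (j : J) : MvPolynomial (W n J) R := inc (F j) - C π * X (Sum.inr j)

/-- The relation `p_{k,ℓ} = a_k z_ℓ - ∑_{j ∈ E_k} h^j_{k,ℓ} z_j - π g_{k,ℓ}`.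
[cite: StacksProject, Tag 07CP] -/
def relP (k : Fin r) (ℓ : J) : MvPolynomial (W n J) R :=
  inc (ak k) * X (Sum.inr ℓ) - ∑ i, inc (h k ℓ i) * X (Sum.inr (ι k i)) - C π * inc (g k ℓ)

/-- All the relations of `D`. [cite: StacksProject, Tag 07CP] -/
def relD : J ⊕ (Fin r × J) → MvPolynomial (W n J) R :=
  Sum.elim (relF π F) fun kl => relP π ι ak h g kl.1 kl.2

/-- The ideal of relations of `D`. [cite: StacksProject, Tag 07CP] -/
abbrev idealD : Ideal (MvPolynomial (W n J) R) := Ideal.span (Set.range (relD π F ι ak h g))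

/-- `D = R[x_1, …, x_n, z_1, …, z_m]/(f_j - π z_j, p_{k,ℓ})`. [cite: StacksProject, Tag 07CP] -/
abbrev Dalg : Type u := MvPolynomial (W n J) R ⧸ idealD π F ι ak h g

/-- `D` is of finite presentation over `R` ((a) of Stacks 07CP). [cite: StacksProject, Tag 07CP] -/
instance [Finite J] : Algebra.FinitePresentation R (Dalg π F ι ak h g) :=
  Algebra.FinitePresentation.quotient (Submodule.fg_span (Set.finite_range _))

/-- `f_j - π z_j` is a relation of `D`. [folklore] -/
theorem relF_mem (j : J) : relF π F j ∈ idealD π F ι ak h g :=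
  Ideal.subset_span ⟨Sum.inl j, rfl⟩

/-- `p_{k,ℓ}` is a relation of `D`. [folklore] -/
theorem relP_mem (k : Fin r) (ℓ : J) : relP π ι ak h g k ℓ ∈ idealD π F ι ak h g :=
  Ideal.subset_span ⟨Sum.inr (k, ℓ), rfl⟩

/-- `f_j = π z_j` in `D`. [cite: StacksProject, Tag 07CP] -/
theorem mk_inc_F (j : J) :
    Ideal.Quotient.mk (idealD π F ι ak h g) (inc (F j)) =
      algebraMap R (Dalg π F ι ak h g) π * Ideal.Quotient.mk _ (X (Sum.inr j)) := by
  have h1 : Ideal.Quotient.mk (idealD π F ι ak h g) (relF π F j) = 0 :=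
    Ideal.Quotient.eq_zero_iff_mem.mpr (relF_mem π F ι ak h g j)
  rw [relF, map_sub, sub_eq_zero, map_mul] at h1
  rw [h1]
  rfl

variable (h4 : ∀ k ℓ, ak k * F ℓ = ∑ i, h k ℓ i * F (ι k i) + C (π ^ 2) * g k ℓ)

include h4 in
/-- **The key equality** `π p_{k,ℓ} = -a_k (f_ℓ - π z_ℓ) + ∑_{j ∈ E_k} h^j_{k,ℓ} (f_j - π z_j)`.
[cite: StacksProject, Tag 07CP] -/
theorem C_mul_relP (k : Fin r) (ℓ : J) :
    C π * relP π ι ak h g k ℓ =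
      -(inc (ak k) * relF π F ℓ) + ∑ i, inc (h k ℓ i) * relF π F (ι k i) := by
  have e := congrArg (inc (R := R) (n := n) (J := J)) (h4 k ℓ)
  simp only [map_mul, map_add, map_sum, rename_C, map_pow] at e
  have hs : ∑ i, inc (h k ℓ i) * relF π F (ι k i) =
      (∑ i, inc (h k ℓ i) * inc (F (ι k i))) -
        C π * ∑ i, inc (h k ℓ i) * (X (Sum.inr (ι k i)) : MvPolynomial (W n J) R) := by
    rw [Finset.mul_sum, ← Finset.sum_sub_distrib]
    exact Finset.sum_congr rfl fun i _ => by rw [relF]; ring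
  rw [hs, relP, relF]
  linear_combination e

include h4 in
/-- `π p_{k,ℓ} ∈ (f_j - π z_j)_j`. [cite: StacksProject, Tag 07CP] -/
theorem C_mul_relP_mem_span_relF (k : Fin r) (ℓ : J) :
    C π * relP π ι ak h g k ℓ ∈ Ideal.span (Set.range (relF π F)) := by
  rw [C_mul_relP π F ι ak h g h4]
  refine Ideal.add_mem _ (neg_mem (Ideal.mul_mem_left _ _ (Ideal.subset_span ⟨ℓ, rfl⟩)))
    (Ideal.sum_mem _ fun i _ => Ideal.mul_mem_left _ _ (Ideal.subset_span ⟨ι k i, rfl⟩))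

/-! ### The map `D → Λ` -/

section ToΛ

variable {Λ : Type u} [CommRing Λ] [Algebra R Λ] (lam : Fin n → Λ) (μ : J → Λ)

/-- `R[x, z] → Λ`, `x_i ↦ λ_i`, `z_j ↦ π μ_j`. [cite: StacksProject, Tag 07CP] -/
abbrev evΛ : MvPolynomial (W n J) R →ₐ[R] Λ :=
  aeval (Sum.elim lam fun j => algebraMap R Λ π * μ j)

/-- `R[x] → R[x, z] → Λ` is `x ↦ λ`. [folklore] -/
theorem evΛ_inc (p : MvPolynomial (Fin n) R) : evΛ π lam μ (inc p) = aeval lam p := by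
  rw [aeval_rename]
  rfl

variable (hμ : ∀ j, aeval lam (F j) = algebraMap R Λ π ^ 2 * μ j)
  (hΛ : ∀ x : Λ, algebraMap R Λ π ^ 2 * x = 0 → algebraMap R Λ π * x = 0)

include hμ in
/-- `f_j - π z_j ↦ f_j(λ) - π² μ_j = 0`. [cite: StacksProject, Tag 07CP] -/
theorem evΛ_relF (j : J) : evΛ π lam μ (relF π F j) = 0 := by
  simp only [relF, map_sub, map_mul, evΛ_inc, aeval_C, aeval_X, Sum.elim_inr, hμ]
  ring

include hμ hΛ h4 in
/-- `p_{k,ℓ} ↦ π(a_k(λ) μ_ℓ - ∑ h(λ) μ_j - g(λ))` and the bracket is killed by `π²`, hence by `π`.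
[cite: StacksProject, Tag 07CP] -/
theorem evΛ_relP (k : Fin r) (ℓ : J) : evΛ π lam μ (relP π ι ak h g k ℓ) = 0 := by
  set y : Λ := aeval lam (ak k) * μ ℓ - ∑ i, aeval lam (h k ℓ i) * μ (ι k i) - aeval lam (g k ℓ)
    with hy
  have hev : evΛ π lam μ (relP π ι ak h g k ℓ) = algebraMap R Λ π * y := by
    simp only [relP, map_sub, map_mul, map_sum, evΛ_inc, aeval_C, aeval_X, Sum.elim_inr, hy,
      mul_sub, Finset.mul_sum]
    congr 1
    · congr 1
      · ring
      · exact Finset.sum_congr rfl fun i _ => by ring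
  have h2 : algebraMap R Λ π ^ 2 * y = 0 := by
    have e := congrArg (aeval lam) (h4 k ℓ)
    simp only [map_mul, map_add, map_sum, aeval_C, map_pow, hμ] at e
    rw [hy, mul_sub, mul_sub, Finset.mul_sum]
    have e' : algebraMap R Λ π ^ 2 * (aeval lam (ak k) * μ ℓ) =
        ∑ i, algebraMap R Λ π ^ 2 * (aeval lam (h k ℓ i) * μ (ι k i)) +
          algebraMap R Λ π ^ 2 * aeval lam (g k ℓ) := by
      have : ∑ i, algebraMap R Λ π ^ 2 * (aeval lam (h k ℓ i) * μ (ι k i)) =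
          ∑ i, aeval lam (h k ℓ i) * (algebraMap R Λ π ^ 2 * μ (ι k i)) :=
        Finset.sum_congr rfl fun i _ => by ring
      rw [this, mul_left_comm, e]
    rw [e']
    ring
  rw [hev, hΛ y h2]

/-- `D → Λ`. [cite: StacksProject, Tag 07CP] -/
def toΛ : Dalg π F ι ak h g →ₐ[R] Λ :=
  Ideal.Quotient.liftₐ (idealD π F ι ak h g) (evΛ π lam μ) fun a ha => by
    rw [← RingHom.mem_ker]
    refine (Ideal.span_le.mpr ?_) ha
    rintro _ ⟨j | ⟨k, ℓ⟩, rfl⟩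
    · exact evΛ_relF π F lam μ hμ j
    · exact evΛ_relP π F ι ak h g h4 lam μ hμ hΛ k ℓ

/-- Formula for `D → Λ`. [folklore] -/
theorem toΛ_mk (p : MvPolynomial (W n J) R) :
    toΛ π F ι ak h g h4 lam μ hμ hΛ (Ideal.Quotient.mk _ p) = evΛ π lam μ p := rfl

end ToΛ

/-! ### The map `C̄ → D/πD` -/

section Eps

/-- `πD`. [folklore] -/
abbrev πD : Ideal (Dalg π F ι ak h g) := Ideal.span {algebraMap R (Dalg π F ι ak h g) π}

/-- `R[x] → D → D/πD`. [cite: StacksProject, Tag 07CP] -/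
def toDmod₀ : MvPolynomial (Fin n) R →ₐ[R] Dalg π F ι ak h g ⧸ πD π F ι ak h g :=
  (Ideal.Quotient.mkₐ R (πD π F ι ak h g)).comp
    ((Ideal.Quotient.mkₐ R (idealD π F ι ak h g)).comp inc)

/-- Formula for `R[x] → D/πD`. [folklore] -/
theorem toDmod₀_apply (p : MvPolynomial (Fin n) R) :
    toDmod₀ π F ι ak h g p =
      Ideal.Quotient.mk (πD π F ι ak h g) (Ideal.Quotient.mk (idealD π F ι ak h g) (inc p)) := rfl

/-- `f_j ↦ π z_j ≡ 0` in `D/πD` ("clearly well defined"). [cite: StacksProject, Tag 07CP] -/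
theorem toDmod₀_F (j : J) : toDmod₀ π F ι ak h g (F j) = 0 := by
  rw [toDmod₀_apply, mk_inc_F, Ideal.Quotient.eq_zero_iff_mem]
  exact Ideal.mul_mem_right _ _ (Ideal.mem_span_singleton_self _)

variable {Cb : Type u} [CommRing Cb] [Algebra R Cb] (val : Fin n → Cb)
  (hval : Function.Surjective (aeval (R := R) val))
  (hker : ∀ f : MvPolynomial (Fin n) R, aeval val f = 0 → f ∈ Ideal.span (Set.range F))

include hker in
/-- `ker(R[x] → C̄)` dies in `D/πD`. [cite: StacksProject, Tag 07CP] -/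
theorem toDmod₀_eq_zero_of_mem_ker :
    ∀ f ∈ RingHom.ker (aeval (R := R) val), toDmod₀ π F ι ak h g f = 0 := by
  intro f hf
  rw [RingHom.mem_ker] at hf
  have key : Ideal.span (Set.range F) ≤ RingHom.ker (toDmod₀ π F ι ak h g) := by
    refine Ideal.span_le.mpr ?_
    rintro _ ⟨j, rfl⟩
    exact toDmod₀_F π F ι ak h g j
  exact key (hker f hf)

/-- `ε : C̄ → D/πD`, `x_i ↦ x_i`. [cite: StacksProject, Tag 07CP] -/
def eps : Cb →ₐ[R] Dalg π F ι ak h g ⧸ πD π F ι ak h g :=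
  (Ideal.Quotient.liftₐ (RingHom.ker (aeval (R := R) val)) (toDmod₀ π F ι ak h g)
      (toDmod₀_eq_zero_of_mem_ker π F ι ak h g val hker)).comp
    (Ideal.quotientKerAlgEquivOfSurjective hval).symm.toAlgHom

/-- `ε` on the image of a polynomial. [folklore] -/
theorem eps_aeval (p : MvPolynomial (Fin n) R) :
    eps π F ι ak h g val hval hker (aeval val p) = toDmod₀ π F ι ak h g p := by
  have h1 : (Ideal.quotientKerAlgEquivOfSurjective hval).symm (aeval val p) =
      Ideal.Quotient.mk _ p := by
    rw [AlgEquiv.symm_apply_eq]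
    rfl
  rw [eps, AlgHom.comp_apply]
  change Ideal.Quotient.liftₐ _ (toDmod₀ π F ι ak h g) _
    ((Ideal.quotientKerAlgEquivOfSurjective hval).symm (aeval val p)) = _
  rw [h1]
  rfl

end Eps

/-! ### `D_π` is a retract of `R_π[x]` -/

section AwayPi

/-- `R_π`. [folklore] -/
abbrev Rπ (R : Type u) [CommRing R] (π : R) : Type u := Localization.Away π

/-- the inverse of `π` in `R_π`. [folklore] -/
def πinv : Rπ R π :=
  ((IsLocalization.Away.algebraMap_isUnit (S := Rπ R π) π).unit⁻¹ : (Rπ R π)ˣ)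

/-- `π · π⁻¹ = 1` in `R_π`. [folklore] -/
theorem algebraMap_mul_πinv : algebraMap R (Rπ R π) π * πinv π = 1 := by
  rw [πinv]
  exact (IsLocalization.Away.algebraMap_isUnit (S := Rπ R π) π).mul_val_inv

/-- `R[x, z] → R_π[x]`, `x ↦ x`, `z_j ↦ f_j/π`. [cite: StacksProject, Tag 07CP] -/
abbrev ξpoly : MvPolynomial (W n J) R →ₐ[R] MvPolynomial (Fin n) (Rπ R π) :=
  aeval (Sum.elim X fun j => C (πinv π) * MvPolynomial.map (algebraMap R (Rπ R π)) (F j))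

/-- `R[x] → R[x, z] → R_π[x]` is the change of coefficients. [folklore] -/
theorem ξpoly_inc (p : MvPolynomial (Fin n) R) :
    ξpoly π F (inc p) = MvPolynomial.map (algebraMap R (Rπ R π)) p := by
  rw [aeval_rename]
  change aeval (X : Fin n → MvPolynomial (Fin n) (Rπ R π)) p = _
  rw [← MvPolynomial.aeval_map_algebraMap (Rπ R π), aeval_X_left_apply]

/-- `f_j - π z_j ↦ f_j - π f_j/π = 0`. [cite: StacksProject, Tag 07CP] -/
theorem ξpoly_relF (j : J) : ξpoly π F (relF π F j) = 0 := by
  rw [relF, map_sub, map_mul, ξpoly_inc, aeval_C, aeval_X, Sum.elim_inr, ← mul_assoc,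
    MvPolynomial.algebraMap_apply, ← map_mul, algebraMap_mul_πinv, map_one, one_mul, sub_self]

include h4 in
/-- `p_{k,ℓ} ↦ 0` in `R_π[x]` (from the key equality, `π` being a unit). [cite: StacksProject, Tag 07CP] -/
theorem ξpoly_relP (k : Fin r) (ℓ : J) : ξpoly π F (relP π ι ak h g k ℓ) = 0 := by
  have h1 : ξpoly π F (C π * relP π ι ak h g k ℓ) = 0 := by
    rw [C_mul_relP π F ι ak h g h4]
    simp only [map_add, map_neg, map_sum, map_mul, ξpoly_relF, mul_zero, neg_zero,
      Finset.sum_const_zero, add_zero]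
  rw [map_mul, aeval_C, MvPolynomial.algebraMap_apply] at h1
  have hu : IsUnit (C (σ := Fin n) (algebraMap R (Rπ R π) π)) :=
    (IsLocalization.Away.algebraMap_isUnit (S := Rπ R π) π).map C
  exact hu.mul_right_eq_zero.mp h1

/-- `D → R_π[x]`. [cite: StacksProject, Tag 07CP] -/
def ξD : Dalg π F ι ak h g →ₐ[R] MvPolynomial (Fin n) (Rπ R π) :=
  Ideal.Quotient.liftₐ (idealD π F ι ak h g) (ξpoly π F) fun a ha => by
    rw [← RingHom.mem_ker]
    refine (Ideal.span_le.mpr ?_) ha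
    rintro _ ⟨j | ⟨k, ℓ⟩, rfl⟩
    · exact ξpoly_relF π F j
    · exact ξpoly_relP π F ι ak h g h4 k ℓ

/-- Formula for `D → R_π[x]`. [folklore] -/
theorem ξD_mk (p : MvPolynomial (W n J) R) :
    ξD π F ι ak h g h4 (Ideal.Quotient.mk _ p) = ξpoly π F p := rfl

/-- `D_π`. [folklore] -/
abbrev Dπ : Type u := Localization.Away (algebraMap R (Dalg π F ι ak h g) π)

/-- `π` becomes a unit in `R_π[x]`. [folklore] -/
theorem isUnit_ξD : ∀ y : Submonoid.powers (algebraMap R (Dalg π F ι ak h g) π),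
    IsUnit (ξD π F ι ak h g h4 y) := by
  rintro ⟨_, k, rfl⟩
  rw [map_pow, AlgHom.commutes, MvPolynomial.algebraMap_apply]
  exact ((IsLocalization.Away.algebraMap_isUnit (S := Rπ R π) π).map C).pow k

/-- `Ξ : D_π → R_π[x]`. [cite: StacksProject, Tag 07CP] -/
def ΞDπ : Dπ π F ι ak h g →ₐ[R] MvPolynomial (Fin n) (Rπ R π) :=
  IsLocalization.liftAlgHom (M := Submonoid.powers (algebraMap R (Dalg π F ι ak h g) π))
    (f := ξD π F ι ak h g h4) (isUnit_ξD π F ι ak h g h4)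

/-- `π` becomes a unit in `D_π`. [folklore] -/
theorem isUnit_algebraMap_Dπ : ∀ y : Submonoid.powers π,
    IsUnit (algebraMap R (Dπ π F ι ak h g) y) := by
  rintro ⟨_, k, rfl⟩
  rw [map_pow, IsScalarTower.algebraMap_apply R (Dalg π F ι ak h g) (Dπ π F ι ak h g)]
  exact (IsLocalization.Away.algebraMap_isUnit (S := Dπ π F ι ak h g)
    (algebraMap R (Dalg π F ι ak h g) π)).pow k

/-- `R_π → D_π`. [folklore] -/
def θRπ : Rπ R π →ₐ[R] Dπ π F ι ak h g :=
  IsLocalization.liftAlgHom (M := Submonoid.powers π) (f := Algebra.ofId R (Dπ π F ι ak h g))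
    (isUnit_algebraMap_Dπ π F ι ak h g)

/-- `Θ : R_π[x] → D_π`, `x_i ↦ x_i`. [cite: StacksProject, Tag 07CP] -/
def ΘDπ : MvPolynomial (Fin n) (Rπ R π) →ₐ[R] Dπ π F ι ak h g :=
  aevalTower (θRπ π F ι ak h g)
    fun i => algebraMap (Dalg π F ι ak h g) _ (Ideal.Quotient.mk _ (X (Sum.inl i)))

/-- `Ξ` extends `D → R_π[x]`. [folklore] -/
theorem ΞDπ_algebraMap (d : Dalg π F ι ak h g) :
    ΞDπ π F ι ak h g h4 (algebraMap _ (Dπ π F ι ak h g) d) = ξD π F ι ak h g h4 d := by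
  rw [ΞDπ, IsLocalization.liftAlgHom_apply, IsLocalization.lift_eq]
  rfl

/-- `R_π → D_π` extends `R → D_π`. [folklore] -/
theorem θRπ_algebraMap (x : R) :
    θRπ π F ι ak h g (algebraMap R (Rπ R π) x) = algebraMap R (Dπ π F ι ak h g) x := by
  rw [θRπ, IsLocalization.liftAlgHom_apply, IsLocalization.lift_eq]
  rfl

/-- `Θ` on polynomials with coefficients in `R`. [folklore] -/
theorem ΘDπ_map (p : MvPolynomial (Fin n) R) :
    ΘDπ π F ι ak h g (MvPolynomial.map (algebraMap R (Rπ R π)) p) =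
      algebraMap (Dalg π F ι ak h g) (Dπ π F ι ak h g) (Ideal.Quotient.mk _ (inc p)) := by
  have hmap : MvPolynomial.map (algebraMap R (Rπ R π)) p =
      aeval (X : Fin n → MvPolynomial (Fin n) (Rπ R π)) p := by
    rw [← MvPolynomial.aeval_map_algebraMap (Rπ R π), aeval_X_left_apply]
  have h1 : (ΘDπ π F ι ak h g).comp (aeval (X : Fin n → MvPolynomial (Fin n) (Rπ R π))) =
      ((IsScalarTower.toAlgHom R (Dalg π F ι ak h g) (Dπ π F ι ak h g)).comp
        (Ideal.Quotient.mkₐ R (idealD π F ι ak h g))).comp inc := by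
    refine MvPolynomial.algHom_ext fun i => ?_
    simp only [AlgHom.comp_apply, aeval_X, IsScalarTower.coe_toAlgHom', Ideal.Quotient.mkₐ_eq_mk,
      rename_X]
    rw [ΘDπ, aevalTower_X]
  rw [hmap]
  exact AlgHom.congr_fun h1 p

set_option maxHeartbeats 400000 in
/-- `Θ ∘ Ξ = id` on `D_π`: `D_π` is a retract of `R_π[x]` (Stacks: "`D[1/π]` is isomorphic to
`R[1/π][x_1, …, x_n, z_1, …, z_m]/(f_j - π z_j)` which is isomorphic to `R[1/π][x_1, …, x_n]`").
[cite: StacksProject, Tag 07CP] -/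
theorem ΘDπ_comp_ΞDπ :
    (ΘDπ π F ι ak h g).comp (ΞDπ π F ι ak h g h4) = AlgHom.id R _ := by
  have key : ((ΘDπ π F ι ak h g).comp (ΞDπ π F ι ak h g h4)).comp
      (IsScalarTower.toAlgHom R (Dalg π F ι ak h g) (Dπ π F ι ak h g)) =
      IsScalarTower.toAlgHom R (Dalg π F ι ak h g) (Dπ π F ι ak h g) := by
    refine Ideal.Quotient.algHom_ext R (MvPolynomial.algHom_ext fun v => ?_)
    simp only [AlgHom.comp_apply, Ideal.Quotient.mkₐ_eq_mk, IsScalarTower.coe_toAlgHom',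
      ΞDπ_algebraMap, ξD_mk, aeval_X]
    rcases v with i | j
    · rw [Sum.elim_inl, ΘDπ, aevalTower_X]
    · rw [Sum.elim_inr, map_mul, ΘDπ_map, mk_inc_F, map_mul, ← mul_assoc,
        ← IsScalarTower.algebraMap_apply R (Dalg π F ι ak h g) (Dπ π F ι ak h g)]
      rw [ΘDπ, aevalTower_C]
      have hunit : θRπ π F ι ak h g (πinv π) * algebraMap R (Dπ π F ι ak h g) π = 1 := by
        rw [← θRπ_algebraMap π F ι ak h g π, ← map_mul, mul_comm, algebraMap_mul_πinv, map_one]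
      rw [hunit, one_mul]
  refine AlgHom.coe_ringHom_injective (IsLocalization.ringHom_ext
    (Submonoid.powers (algebraMap R (Dalg π F ι ak h g) π)) ?_)
  exact congrArg AlgHom.toRingHom key

include h4 in
/-- **(b) of Stacks 07CP**: `D_π` is formally smooth over `R` (a retract of `R_π[x]`).
[cite: StacksProject, Tag 07CP] -/
theorem formallySmooth_Dπ : Algebra.FormallySmooth R (Dπ π F ι ak h g) := by
  haveI : Algebra.FormallySmooth R (Rπ R π) :=
    Algebra.FormallySmooth.of_isLocalization (Submonoid.powers π)
  haveI : Algebra.FormallySmooth (Rπ R π) (MvPolynomial (Fin n) (Rπ R π)) := inferInstance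
  haveI : Algebra.FormallySmooth R (MvPolynomial (Fin n) (Rπ R π)) :=
    Algebra.FormallySmooth.comp R (Rπ R π) _
  exact formallySmooth_of_retract (ΞDπ π F ι ak h g h4) (ΘDπ π F ι ak h g)
    (ΘDπ_comp_ΞDπ π F ι ak h g h4)

include h4 in
/-- **(b)**: `π ∈ H_{D/R}`. [cite: StacksProject, Tag 07CP] -/
theorem algebraMap_pi_mem_singularIdeal [Finite J] :
    algebraMap R (Dalg π F ι ak h g) π ∈ singularIdeal R (Dalg π F ι ak h g) := by
  rw [mem_singularIdeal_iff]
  exact (Algebra.basicOpen_subset_smoothLocus_iff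
    (f := algebraMap R (Dalg π F ι ak h g) π)).mpr (formallySmooth_Dπ π F ι ak h g h4)

end AwayPi

end Algebra

/-! ## P6. The algebras `D_k` and their Jacobians -/

section Chart

variable {R : Type u} [CommRing R] (π : R) {n : ℕ} {J : Type}
  (F : J → MvPolynomial (Fin n) R) {r : ℕ} {c : Fin r → ℕ} (ι : ∀ k, Fin (c k) → J)
  (ak : Fin r → MvPolynomial (Fin n) R)
  (h : ∀ k : Fin r, J → Fin (c k) → MvPolynomial (Fin n) R)
  (g : Fin r → J → MvPolynomial (Fin n) R)
  (h4 : ∀ k ℓ, ak k * F ℓ = ∑ i, h k ℓ i * F (ι k i) + C (π ^ 2) * g k ℓ) (k : Fin r)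

/-- The complement of `E_k` in the index set of the relations. [cite: StacksProject, Tag 07CP] -/
abbrev Jc : Type := {ℓ : J // ℓ ∉ Set.range (ι k)}

/-- The relations of `D_k`: `f_j - π z_j` for `j ∈ E_k` and `p_{k,ℓ}` for `ℓ ∉ E_k`.
[cite: StacksProject, Tag 07CP] -/
def relK : Fin (c k) ⊕ Jc ι k → MvPolynomial (W n J) R :=
  Sum.elim (fun i => relF π F (ι k i)) fun ℓ => relP π ι ak h g k ℓ.1

/-- the ideal of `D_k`. [folklore] -/
abbrev idealK : Ideal (MvPolynomial (W n J) R) := Ideal.span (Set.range (relK π F ι ak h g k))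

/-- `D_k = R[x, z]/(f_j - π z_j, j ∈ E_k, p_{k,ℓ})`. [cite: StacksProject, Tag 07CP] -/
abbrev DK : Type u := MvPolynomial (W n J) R ⧸ idealK π F ι ak h g k

/-- The quotient map `R[x, z] → D_k`. [folklore] -/
abbrev mkK : MvPolynomial (W n J) R →ₐ[R] DK π F ι ak h g k :=
  Ideal.Quotient.mkₐ R (idealK π F ι ak h g k)

variable (p : Fin (c k) → Fin n) (hp : Function.Injective p)

/-- The distinguished variables of `D_k`: `x_{p(i)}` for the relations `f_j - π z_j`, `j ∈ E_k`,
and `z_ℓ` for `p_{k,ℓ}`. [cite: StacksProject, Tag 07CP] -/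
def mapK : Fin (c k) ⊕ Jc ι k → W n J := Sum.map p Subtype.val

include hp in
/-- The distinguished variables are distinct. [folklore] -/
theorem mapK_injective : Function.Injective (mapK ι k p) :=
  hp.sumMap Subtype.val_injective

/-- The naive pre-submersive presentation of `D_k`. [cite: StacksProject, Tag 07CP] -/
def preK : Algebra.PreSubmersivePresentation R (DK π F ι ak h g k) (W n J) (Fin (c k) ⊕ Jc ι k) :=
  Algebra.PreSubmersivePresentation.naive (mapK ι k p) (mapK_injective ι k p hp)

/-- The structure map of the naive presentation is the quotient map. [folklore] -/
theorem algebraMap_preK (x : MvPolynomial (W n J) R) :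
    algebraMap (preK π F ι ak h g k p hp).Ring (DK π F ι ak h g k) x = mkK π F ι ak h g k x := by
  rw [Algebra.Generators.algebraMap_apply]
  have : (aeval (preK π F ι ak h g k p hp).val : MvPolynomial (W n J) R →ₐ[R] DK π F ι ak h g k) =
      mkK π F ι ak h g k := MvPolynomial.algHom_ext fun v => by
    rw [aeval_X]; rfl
  exact AlgHom.congr_fun this x

/-- The minor `(∂f_{ι j}/∂x_{p i})_{i,j}` of the Jacobian of the chart relations.
[cite: StacksProject, Tag 07CP] -/
def minor : Matrix (Fin (c k)) (Fin (c k)) (MvPolynomial (Fin n) R) :=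
  Matrix.of fun i j => pderiv (p i) (F (ι k j))

/-- `∂/∂x_i` commutes with `R[x] → R[x, z]`. [folklore] -/
theorem pderiv_inl_inc (i : Fin n) (f : MvPolynomial (Fin n) R) :
    pderiv (Sum.inl i) (inc (J := J) f) = inc (pderiv i f) :=
  pderiv_rename Sum.inl_injective i f

/-- `∂/∂z_ℓ` kills `R[x]`. [folklore] -/
theorem pderiv_inr_inc (ℓ : J) (f : MvPolynomial (Fin n) R) :
    pderiv (Sum.inr ℓ) (inc (J := J) f) = 0 := by
  classical
  refine pderiv_eq_zero_of_notMem_vars ?_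
  intro hmem
  obtain ⟨i, -, hi⟩ := Finset.mem_image.mp (vars_rename _ _ hmem)
  exact Sum.inl_ne_inr hi

/-- `∂(f_j - π z_j)/∂x_i = ∂f_j/∂x_i`. [cite: StacksProject, Tag 07CP] -/
theorem pderiv_inl_relF (i : Fin n) (j : J) :
    pderiv (Sum.inl i) (relF π F j) = inc (pderiv i (F j)) := by
  classical
  rw [relF, map_sub, pderiv_inl_inc, Derivation.leibniz, pderiv_C, smul_zero, add_zero, pderiv_X,
    Pi.single_eq_of_ne Sum.inr_ne_inl, smul_zero, sub_zero]

/-! ### The relations of `D` modulo those of `D_k` -/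

variable (hh : ∀ k i, h k (ι k i) = Pi.single i (ak k)) (hg : ∀ k i, g k (ι k i) = 0)

include hh hg in
/-- `p_{k, ι i} = 0` ("for `ℓ ∈ E_k` we have `p_{k,ℓ} = 0` by our choices"). [cite: StacksProject, Tag 07CP] -/
theorem relP_self (i : Fin (c k)) : relP π ι ak h g k (ι k i) = 0 := by
  rw [relP, hh, hg, map_zero, mul_zero, sub_zero, Finset.sum_eq_single i, Pi.single_eq_same,
    sub_self]
  · intro i' _ hi'
    rw [Pi.single_eq_of_ne hi', map_zero, zero_mul]
  · intro hi; exact absurd (Finset.mem_univ i) hi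

include hh hg in
/-- every `p_{k,ℓ}` is a relation of `D_k` (trivially so for `ℓ ∈ E_k`). [cite: StacksProject, Tag 07CP] -/
theorem relP_mem_idealK (ℓ : J) : relP π ι ak h g k ℓ ∈ idealK π F ι ak h g k := by
  by_cases hℓ : ℓ ∈ Set.range (ι k)
  · obtain ⟨i, rfl⟩ := hℓ
    rw [relP_self π ι ak h g k hh hg]
    exact Ideal.zero_mem _
  · exact Ideal.subset_span ⟨Sum.inr ⟨ℓ, hℓ⟩, rfl⟩

/-- `f_j - π z_j`, `j ∈ E_k`, is a relation of `D_k`. [cite: StacksProject, Tag 07CP] -/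
theorem relF_ι_mem_idealK (i : Fin (c k)) : relF π F (ι k i) ∈ idealK π F ι ak h g k :=
  Ideal.subset_span ⟨Sum.inl i, rfl⟩

include h4 hh hg in
/-- `a_k (f_ℓ - π z_ℓ) ∈ (relations of D_k)` (Stacks: "`f_ℓ - π z_ℓ` maps to zero in `(D_k)_{a_k}`").
[cite: StacksProject, Tag 07CP] -/
theorem ak_mul_relF_mem_idealK (ℓ : J) : inc (ak k) * relF π F ℓ ∈ idealK π F ι ak h g k := by
  have e := C_mul_relP π F ι ak h g h4 k ℓ
  have : inc (ak k) * relF π F ℓ =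
      (∑ i, inc (h k ℓ i) * relF π F (ι k i)) - C π * relP π ι ak h g k ℓ := by
    rw [e]; ring
  rw [this]
  exact Ideal.sub_mem _ (Ideal.sum_mem _ fun i _ => Ideal.mul_mem_left _ _
    (relF_ι_mem_idealK π F ι ak h g k i)) (Ideal.mul_mem_left _ _ (relP_mem_idealK π F ι ak h g k hh hg ℓ))

include h4 hh hg in
/-- `a_k · f ∈ (relations of D_k) + (π)` for `f ∈ (f_1, …, f_m)`. [cite: StacksProject, Tag 07CP] -/
theorem ak_mul_mem_sup {f : MvPolynomial (Fin n) R} (hf : f ∈ Ideal.span (Set.range F)) :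
    inc (ak k) * inc (J := J) f ∈ idealK π F ι ak h g k ⊔ Ideal.span {C π} := by
  induction hf using Submodule.span_induction with
  | mem x hx =>
    obtain ⟨ℓ, rfl⟩ := hx
    have : inc (ak k) * inc (J := J) (F ℓ) =
        inc (ak k) * relF π F ℓ + C π * (inc (ak k) * X (Sum.inr ℓ)) := by rw [relF]; ring
    rw [this]
    exact Ideal.add_mem _ (Ideal.mem_sup_left (ak_mul_relF_mem_idealK π F ι ak h g h4 k hh hg ℓ))
      (Ideal.mem_sup_right (Ideal.mul_mem_right _ _ (Ideal.mem_span_singleton_self _)))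
  | zero => rw [map_zero, mul_zero]; exact Ideal.zero_mem _
  | add x y _ _ hx hy => rw [map_add, mul_add]; exact Ideal.add_mem _ hx hy
  | smul a x _ hx =>
    rw [smul_eq_mul, map_mul, mul_left_comm]
    exact Ideal.mul_mem_left _ _ hx

/-- The "cocycle defect" `c_j = a_{k'} h^j_{k,ℓ} - ∑_{j'} h^{j'}_{k',ℓ} h^j_{k,j'}`.
[cite: StacksProject, Tag 07CP] -/
def cc (k' : Fin r) (ℓ : J) (j : Fin (c k)) : MvPolynomial (Fin n) R :=
  ak k' * h k ℓ j - ∑ j', h k' ℓ j' * h k (ι k' j') j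

/-- The `π`-part. [folklore] -/
def Gp (k' : Fin r) (ℓ : J) : MvPolynomial (W n J) R :=
  -(inc (ak k) * inc (g k' ℓ)) + inc (ak k') * inc (g k ℓ) -
    ∑ j', inc (h k' ℓ j') * inc (g k (ι k' j'))

/-- **"Computing modulo `π`"**: `a_k p_{k',ℓ} - a_{k'} p_{k,ℓ} + ∑ h^{j'}_{k',ℓ} p_{k,j'}
= ∑_j c_j z_j + π G`. [cite: StacksProject, Tag 07CP] -/
theorem ak_mul_relP_eq (k' : Fin r) (ℓ : J) :
    inc (ak k) * relP π ι ak h g k' ℓ - inc (ak k') * relP π ι ak h g k ℓ +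
        ∑ j', inc (h k' ℓ j') * relP π ι ak h g k (ι k' j') =
      ∑ j, inc (cc ι ak h k k' ℓ j) * X (Sum.inr (ι k j)) + C π * Gp ι ak h g k k' ℓ := by
  -- the double sum
  have hdouble : ∑ j', inc (h k' ℓ j') *
      (∑ j, inc (h k (ι k' j') j) * (X (Sum.inr (ι k j)) : MvPolynomial (W n J) R)) =
      ∑ j, (∑ j', inc (h k' ℓ j') * inc (h k (ι k' j') j)) * X (Sum.inr (ι k j)) := by
    simp_rw [Finset.mul_sum, Finset.sum_mul]
    rw [Finset.sum_comm]
    exact Finset.sum_congr rfl fun j _ => Finset.sum_congr rfl fun j' _ => by ring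
  have h3 : ∑ j', inc (h k' ℓ j') * relP π ι ak h g k (ι k' j') =
      inc (ak k) * ∑ j', inc (h k' ℓ j') * X (Sum.inr (ι k' j')) -
        ∑ j, (∑ j', inc (h k' ℓ j') * inc (h k (ι k' j') j)) * X (Sum.inr (ι k j)) -
        C π * ∑ j', inc (h k' ℓ j') * inc (g k (ι k' j')) := by
    rw [← hdouble, Finset.mul_sum, Finset.mul_sum, ← Finset.sum_sub_distrib,
      ← Finset.sum_sub_distrib]
    exact Finset.sum_congr rfl fun j' _ => by rw [relP]; ring
  have hcc : ∑ j, inc (cc ι ak h k k' ℓ j) * (X (Sum.inr (ι k j)) : MvPolynomial (W n J) R) =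
      inc (ak k') * ∑ j, inc (h k ℓ j) * X (Sum.inr (ι k j)) -
        ∑ j, (∑ j', inc (h k' ℓ j') * inc (h k (ι k' j') j)) * X (Sum.inr (ι k j)) := by
    rw [Finset.mul_sum, ← Finset.sum_sub_distrib]
    exact Finset.sum_congr rfl fun j _ => by
      simp only [cc, map_sub, map_mul, map_sum]; ring
  rw [h3, hcc, Gp, relP, relP]
  ring

variable (h5 : ∀ k k' ℓ j, ∃ N, ak k ^ N * cc ι ak h k k' ℓ j ∈ Ideal.span (Set.range F))

include h4 hh hg h5 in
/-- `a_k^{N+2} p_{k',ℓ} ∈ (relations of D_k) + (π)` (Stacks: "`a_k^{N+1} p_{k',ℓ}` is contained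
in the ideal generated by `I_k` and `π`"). [cite: StacksProject, Tag 07CP] -/
theorem exists_pow_mul_relP_mem_sup (k' : Fin r) (ℓ : J) :
    ∃ N, inc (ak k) ^ N * relP π ι ak h g k' ℓ ∈ idealK π F ι ak h g k ⊔ Ideal.span {C π} := by
  classical
  choose N hN using h5 k k' ℓ
  let M := Finset.univ.sup N
  have hM : ∀ j, ak k ^ M * cc ι ak h k k' ℓ j ∈ Ideal.span (Set.range F) := fun j => by
    have hle : N j ≤ M := Finset.le_sup (Finset.mem_univ j)
    rw [← Nat.sub_add_cancel hle, pow_add, mul_assoc]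
    exact Ideal.mul_mem_left _ _ (hN j)
  refine ⟨M + 2, ?_⟩
  have e := ak_mul_relP_eq π ι ak h g k k' ℓ
  have hrel : inc (ak k) * relP π ι ak h g k' ℓ =
      (∑ j, inc (cc ι ak h k k' ℓ j) * X (Sum.inr (ι k j)) + C π * Gp ι ak h g k k' ℓ) +
        (inc (ak k') * relP π ι ak h g k ℓ - ∑ j', inc (h k' ℓ j') * relP π ι ak h g k (ι k' j')) := by
    rw [← e]; ring
  have : inc (ak k) ^ (M + 2) * relP π ι ak h g k' ℓ =
      inc (ak k) ^ (M + 1) * (inc (ak k) * relP π ι ak h g k' ℓ) := by ring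
  rw [this, hrel, mul_add, mul_add, Finset.mul_sum]
  refine Ideal.add_mem _ (Ideal.add_mem _ (Ideal.sum_mem _ fun j _ => ?_)
    (Ideal.mem_sup_right (Ideal.mul_mem_left _ _ (Ideal.mul_mem_right _ _
      (Ideal.mem_span_singleton_self _))))) (Ideal.mem_sup_left ?_)
  · have : inc (ak k) ^ (M + 1) * (inc (cc ι ak h k k' ℓ j) * X (Sum.inr (ι k j))) =
        X (Sum.inr (ι k j)) * (inc (ak k) * inc (J := J) (ak k ^ M * cc ι ak h k k' ℓ j)) := by
      simp only [map_mul, map_pow]; ring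
    rw [this]
    exact Ideal.mul_mem_left _ _ (ak_mul_mem_sup π F ι ak h g h4 k hh hg (hM j))
  · exact Ideal.mul_mem_left _ _ (Ideal.sub_mem _
      (Ideal.mul_mem_left _ _ (relP_mem_idealK π F ι ak h g k hh hg ℓ))
      (Ideal.sum_mem _ fun j' _ => Ideal.mul_mem_left _ _ (relP_mem_idealK π F ι ak h g k hh hg _)))

include h4 hh hg in
/-- `a_k π p_{k',ℓ} ∈ (relations of D_k)` (Stacks: "`π p_{k',ℓ}` is zero in `(D_k)_{a_k}`").
[cite: StacksProject, Tag 07CP] -/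
theorem ak_mul_C_mul_relP_mem_idealK (k' : Fin r) (ℓ : J) :
    inc (ak k) * (C π * relP π ι ak h g k' ℓ) ∈ idealK π F ι ak h g k := by
  rw [C_mul_relP π F ι ak h g h4 k' ℓ, mul_add, mul_neg, Finset.mul_sum]
  refine Ideal.add_mem _ (neg_mem ?_) (Ideal.sum_mem _ fun i _ => ?_)
  · rw [mul_left_comm]
    exact Ideal.mul_mem_left _ _ (ak_mul_relF_mem_idealK π F ι ak h g h4 k hh hg ℓ)
  · rw [mul_left_comm]
    exact Ideal.mul_mem_left _ _ (ak_mul_relF_mem_idealK π F ι ak h g h4 k hh hg _)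

/-- Constants in `D_k`. [folklore] -/
theorem mkK_C (x : R) : mkK π F ι ak h g k (C x) = algebraMap R (DK π F ι ak h g k) x := by
  rw [← MvPolynomial.algebraMap_eq, AlgHom.commutes]

/-- The relations of `D_k` are among those of `D` ("the surjection `D_k → D`"). [cite: StacksProject, Tag 07CP] -/
theorem idealK_le_idealD : idealK π F ι ak h g k ≤ idealD π F ι ak h g := by
  refine Ideal.span_le.mpr ?_
  rintro _ ⟨i | ℓ, rfl⟩
  · exact relF_mem π F ι ak h g (ι k i)
  · exact relP_mem π F ι ak h g k ℓ.1

/-- `D_k → D`. [cite: StacksProject, Tag 07CP] -/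
def KtoD : DK π F ι ak h g k →ₐ[R] Dalg π F ι ak h g :=
  Ideal.Quotient.factorₐ R (idealK_le_idealD π F ι ak h g k)

/-- Formula for `D_k → D`. [folklore] -/
theorem KtoD_mk (x : MvPolynomial (W n J) R) :
    KtoD π F ι ak h g k (Ideal.Quotient.mk _ x) = Ideal.Quotient.mk _ x := rfl

/-! ### The Jacobian of `D_k` -/

variable [DecidableEq J] [Fintype J]

/-- Membership in `E_k` is decidable. [folklore] -/
instance decMemRange : DecidablePred (· ∈ Set.range (ι k)) := fun ℓ =>
  decidable_of_iff (∃ i, ι k i = ℓ) Set.mem_range.symm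

omit [Fintype J] in
/-- `∂(f_j - π z_j)/∂z_ℓ = -π δ_{jℓ}`. [cite: StacksProject, Tag 07CP] -/
theorem pderiv_inr_relF (ℓ j : J) :
    pderiv (Sum.inr ℓ) (relF π F j) = -(C π * if j = ℓ then 1 else 0) := by
  rw [relF, map_sub, pderiv_inr_inc, zero_sub, Derivation.leibniz, pderiv_C, smul_zero, add_zero,
    pderiv_X, smul_eq_mul, Pi.single_apply]
  simp only [Sum.inr.injEq]

omit [Fintype J] in
/-- `∂p_{k,ℓ}/∂z_{ℓ'} = a_k δ_{ℓℓ'}` for `ℓ' ∉ E_k`. [cite: StacksProject, Tag 07CP] -/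
theorem pderiv_inr_relP (ℓ' ℓ : J) (hℓ' : ℓ' ∉ Set.range (ι k)) :
    pderiv (Sum.inr ℓ') (relP π ι ak h g k ℓ) = inc (ak k) * if ℓ = ℓ' then 1 else 0 := by
  have hsum : pderiv (Sum.inr ℓ')
      (∑ i, inc (h k ℓ i) * X (Sum.inr (ι k i)) : MvPolynomial (W n J) R) = 0 := by
    rw [map_sum]
    refine Finset.sum_eq_zero fun i _ => ?_
    rw [Derivation.leibniz, pderiv_inr_inc, smul_zero, add_zero, pderiv_X,
      Pi.single_eq_of_ne, smul_zero]
    intro heq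
    exact hℓ' ⟨i, Sum.inr_injective heq⟩
  have hC : pderiv (Sum.inr ℓ') (C π * inc (g k ℓ) : MvPolynomial (W n J) R) = 0 := by
    rw [Derivation.leibniz, pderiv_inr_inc, pderiv_C, smul_zero, smul_zero, add_zero]
  rw [relP, map_sub, map_sub, hsum, hC, sub_zero, sub_zero, Derivation.leibniz, pderiv_inr_inc,
    smul_zero, add_zero, pderiv_X, smul_eq_mul, Pi.single_apply]
  simp only [Sum.inr.injEq]

omit [Fintype J] in
/-- The off-diagonal block. [folklore] -/
def blockB : Matrix (Fin (c k)) (Jc ι k) (MvPolynomial (W n J) R) :=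
  Matrix.of fun i ℓ => pderiv (Sum.inl (p i)) (relP π ι ak h g k ℓ.1)

/-- **Block structure of the Jacobian of `D_k`** w.r.t. `(x_p, z_ℓ (ℓ ∉ E_k))`:
upper block triangular with diagonal blocks the minor `(∂f_j/∂x_{p i})` and `a_k · 1`.
[cite: StacksProject, Tag 07CP] -/
theorem jacobiMatrix_preK :
    (preK π F ι ak h g k p hp).jacobiMatrix =
      Matrix.fromBlocks ((minor F ι k p).map inc) (blockB π ι ak h g k p) 0
        (inc (J := J) (ak k) • (1 : Matrix (Jc ι k) (Jc ι k) (MvPolynomial (W n J) R))) := by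
  refine Matrix.ext fun a b => ?_
  rw [preK, Algebra.PreSubmersivePresentation.jacobiMatrix_naive]
  rcases a with i | ℓ' <;> rcases b with j | ℓ <;>
    simp only [relK, mapK, Sum.elim_inl, Sum.elim_inr, Sum.map_inl, Sum.map_inr]
  · rw [Matrix.fromBlocks_apply₁₁, Matrix.map_apply, minor, Matrix.of_apply, pderiv_inl_relF]
  · rw [Matrix.fromBlocks_apply₁₂, blockB, Matrix.of_apply]
  · rw [Matrix.fromBlocks_apply₂₁, Matrix.zero_apply, pderiv_inr_relF, neg_eq_zero, if_neg, mul_zero]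
    intro heq
    exact ℓ'.2 ⟨j, heq⟩
  · rw [Matrix.fromBlocks_apply₂₂, Matrix.smul_apply, Matrix.one_apply,
      pderiv_inr_relP π ι ak h g k _ _ ℓ'.2, smul_eq_mul]
    congr 1
    simp only [Subtype.ext_iff, eq_comm]

/-- `det(Jacobian of D_k) = det(minor) · a_k^{m - |E_k|}`. [cite: StacksProject, Tag 07CP] -/
theorem det_jacobiMatrix_preK :
    (preK π F ι ak h g k p hp).jacobiMatrix.det =
      (inc (J := J) (minor F ι k p).det * inc (J := J) (ak k) ^ Fintype.card (Jc ι k) :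
        MvPolynomial (W n J) R) := by
  rw [jacobiMatrix_preK, Matrix.det_fromBlocks_zero₂₁, Matrix.det_smul, Matrix.det_one, mul_one,
    AlgHom.map_det, AlgHom.mapMatrix_apply]

/-! ### `D_k` localized at `det(Jacobian)·a_k` is standard smooth -/

/-- `det(Jacobian)` as a polynomial. [folklore] -/
abbrev jacPoly : MvPolynomial (W n J) R := (preK π F ι ak h g k p hp).jacobiMatrix.det

/-- `s_k = det(Jacobian) · a_k` as a polynomial. [cite: StacksProject, Tag 07CP] -/
abbrev sPoly : MvPolynomial (W n J) R := jacPoly π F ι ak h g k p hp * inc (ak k)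

/-- The Jacobian of `D_k` is the class of `det(Jacobian matrix)`. [folklore] -/
theorem jacobian_preK :
    (preK π F ι ak h g k p hp).jacobian = mkK π F ι ak h g k (jacPoly π F ι ak h g k p hp) := by
  rw [Algebra.PreSubmersivePresentation.jacobian_eq_jacobiMatrix_det, algebraMap_preK]

/-- `T_k = (D_k)_{s_k}`. [cite: StacksProject, Tag 07CP] -/
abbrev TK : Type u :=
  Localization.Away (mkK π F ι ak h g k (sPoly π F ι ak h g k p hp))

/-- **`(D_k)_{det · a_k}` is standard smooth over `R`** (replacing Stacks' "syntomic with smooth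
fibre, hence smooth at `𝔮_k`"). [cite: StacksProject, Tag 07CP] -/
theorem isStandardSmooth_TK :
    Algebra.IsStandardSmooth R (TK π F ι ak h g k p hp) := by
  let P₁ := preK π F ι ak h g k p hp
  let P₂ := Algebra.SubmersivePresentation.localizationAway (TK π F ι ak h g k p hp)
    (mkK π F ι ak h g k (sPoly π F ι ak h g k p hp))
  let Pc : Algebra.PreSubmersivePresentation R (TK π F ι ak h g k p hp)
      (Unit ⊕ W n J) (Unit ⊕ (Fin (c k) ⊕ Jc ι k)) := P₂.toPreSubmersivePresentation.comp P₁
  have hunit : IsUnit Pc.jacobian := by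
    rw [Algebra.PreSubmersivePresentation.comp_jacobian_eq_jacobian_smul_jacobian, Algebra.smul_def,
      IsUnit.mul_iff]
    refine ⟨?_, P₂.jacobian_isUnit⟩
    have hs : IsUnit (algebraMap (DK π F ι ak h g k) (TK π F ι ak h g k p hp)
        (mkK π F ι ak h g k (jacPoly π F ι ak h g k p hp) * mkK π F ι ak h g k (inc (ak k)))) := by
      rw [← map_mul]
      exact IsLocalization.Away.algebraMap_isUnit _
    rw [← jacobian_preK] at hs
    simp only [map_mul] at hs
    exact isUnit_of_mul_isUnit_left hs
  exact Algebra.SubmersivePresentation.isStandardSmooth ⟨Pc, hunit⟩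

/-- `T_k` is smooth over `R`. [cite: StacksProject, Tag 07CP] -/
instance smooth_TK : Algebra.Smooth R (TK π F ι ak h g k p hp) := by
  haveI := isStandardSmooth_TK π F ι ak h g k p hp
  infer_instance

/-! ### The relations of `D` die in `T_k`; `D_{s_k} ≅ T_k` -/

variable (hR : ∀ s : R, π ^ 2 * s = 0 → π * s = 0)

/-- `a_k` is a unit in `T_k`. [folklore] -/
theorem isUnit_ak_TK : IsUnit (algebraMap (DK π F ι ak h g k) (TK π F ι ak h g k p hp)
    (mkK π F ι ak h g k (inc (ak k)))) := by
  have hs : IsUnit (algebraMap (DK π F ι ak h g k) (TK π F ι ak h g k p hp)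
      (mkK π F ι ak h g k (jacPoly π F ι ak h g k p hp) * mkK π F ι ak h g k (inc (ak k)))) := by
    rw [← map_mul]
    exact IsLocalization.Away.algebraMap_isUnit _
  simp only [map_mul] at hs
  exact isUnit_of_mul_isUnit_right hs

include h4 hh hg in
/-- `f_ℓ - π z_ℓ ↦ 0` in `T_k`. [cite: StacksProject, Tag 07CP] -/
theorem algebraMap_mkK_relF (ℓ : J) :
    algebraMap (DK π F ι ak h g k) (TK π F ι ak h g k p hp) (mkK π F ι ak h g k (relF π F ℓ)) = 0 := by
  have h0 : mkK π F ι ak h g k (inc (ak k) * relF π F ℓ) = 0 :=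
    Ideal.Quotient.eq_zero_iff_mem.mpr (ak_mul_relF_mem_idealK π F ι ak h g h4 k hh hg ℓ)
  rw [map_mul] at h0
  have := congrArg (algebraMap (DK π F ι ak h g k) (TK π F ι ak h g k p hp)) h0
  rw [map_mul, map_zero] at this
  exact (isUnit_ak_TK π F ι ak h g k p hp).mul_right_eq_zero.mp this

include h4 hh hg h5 hR in
/-- `p_{k',ℓ} ↦ 0` in `T_k` (Stacks: "`p_{k',ℓ}` maps into `π (D_k)_{a_k}` … `π p_{k',ℓ}` is zero in
`(D_k)_{a_k}` … since `(D_k)_{𝔮_k}` is smooth hence flat over `R` we see that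
`Ann(π) = Ann(π²)` … We conclude that `p_{k',ℓ}` maps to zero as well"). [cite: StacksProject, Tag 07CP] -/
theorem algebraMap_mkK_relP (k' : Fin r) (ℓ : J) :
    algebraMap (DK π F ι ak h g k) (TK π F ι ak h g k p hp)
      (mkK π F ι ak h g k (relP π ι ak h g k' ℓ)) = 0 := by
  classical
  set D₀ := DK π F ι ak h g k
  set T := TK π F ι ak h g k p hp
  obtain ⟨N, hN⟩ := exists_pow_mul_relP_mem_sup π F ι ak h g h4 k hh hg h5 k' ℓ
  -- `a_k^N p = π y` in `D_k`
  obtain ⟨y, hy⟩ : ∃ y : D₀, mkK π F ι ak h g k (inc (ak k)) ^ N *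
      mkK π F ι ak h g k (relP π ι ak h g k' ℓ) = algebraMap R D₀ π * y := by
    obtain ⟨a, ha, b, hb, hab⟩ := Submodule.mem_sup.mp hN
    obtain ⟨y, rfl⟩ := Ideal.mem_span_singleton'.mp hb
    refine ⟨mkK π F ι ak h g k y, ?_⟩
    rw [← map_pow, ← map_mul, ← hab, map_add, Ideal.Quotient.mkₐ_eq_mk,
      Ideal.Quotient.eq_zero_iff_mem.mpr ha, zero_add, map_mul, mul_comm, ← Ideal.Quotient.mkₐ_eq_mk R,
      mkK_C]
  -- `π p = 0` in `T_k`
  have hπp : algebraMap R T π * algebraMap D₀ T (mkK π F ι ak h g k (relP π ι ak h g k' ℓ)) = 0 := by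
    have h0 : mkK π F ι ak h g k (inc (ak k) * (C π * relP π ι ak h g k' ℓ)) = 0 :=
      Ideal.Quotient.eq_zero_iff_mem.mpr (ak_mul_C_mul_relP_mem_idealK π F ι ak h g h4 k hh hg k' ℓ)
    rw [map_mul, map_mul, mkK_C] at h0
    have := congrArg (algebraMap D₀ T) h0
    rw [map_mul, map_zero] at this
    have := (isUnit_ak_TK π F ι ak h g k p hp).mul_right_eq_zero.mp this
    rwa [map_mul, ← IsScalarTower.algebraMap_apply] at this
  have h1 : algebraMap D₀ T (mkK π F ι ak h g k (inc (ak k))) ^ N *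
      algebraMap D₀ T (mkK π F ι ak h g k (relP π ι ak h g k' ℓ)) =
      algebraMap R T π * algebraMap D₀ T y := by
    rw [← map_pow, ← map_mul, hy, map_mul, ← IsScalarTower.algebraMap_apply]
  have h3 : algebraMap R T π ^ 2 * algebraMap D₀ T y = 0 := by
    rw [pow_two, mul_assoc, ← h1, mul_left_comm, hπp, mul_zero]
  have h6 : algebraMap R T π * algebraMap D₀ T y = 0 :=
    Stacks07CR.pi_mul_eq_zero_of_sq π (r₀ := 1) (fun s hs => by rw [one_mul]; exact hR s hs)
      (by rw [map_one]; exact isUnit_one) _ h3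
  rw [h6] at h1
  exact ((isUnit_ak_TK π F ι ak h g k p hp).pow N).mul_right_eq_zero.mp h1

/-- The element `s_k = det(minor)·a_k^{m-|E_k|+1}` of `D`. [cite: StacksProject, Tag 07CP] -/
def gD : Dalg π F ι ak h g := Ideal.Quotient.mk _ (sPoly π F ι ak h g k p hp)

/-- `s_k = det(minor) · a_k^{m - |E_k| + 1}` in `D`. [cite: StacksProject, Tag 07CP] -/
theorem gD_eq : gD π F ι ak h g k p hp =
    Ideal.Quotient.mk _ (inc (minor F ι k p).det) *
      Ideal.Quotient.mk _ (inc (ak k)) ^ (Fintype.card (Jc ι k) + 1) := by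
  rw [gD, sPoly, jacPoly, det_jacobiMatrix_preK, map_mul, map_mul, map_pow, pow_succ, mul_assoc]

/-- `D_{s_k}`. [folklore] -/
abbrev DgD : Type u := Localization.Away (gD π F ι ak h g k p hp)

/-- `s_k` becomes a unit in `D_{s_k}`. [folklore] -/
theorem isUnit_KtoD : ∀ y : Submonoid.powers (mkK π F ι ak h g k (sPoly π F ι ak h g k p hp)),
    IsUnit (((IsScalarTower.toAlgHom R (Dalg π F ι ak h g) (DgD π F ι ak h g k p hp)).comp
      (KtoD π F ι ak h g k)) y) := by
  rintro ⟨_, e, rfl⟩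
  rw [map_pow, AlgHom.comp_apply, Ideal.Quotient.mkₐ_eq_mk, KtoD_mk, IsScalarTower.coe_toAlgHom']
  exact (IsLocalization.Away.algebraMap_isUnit (S := DgD π F ι ak h g k p hp)
    (gD π F ι ak h g k p hp)).pow e

/-- `Ψ : T_k → D_{s_k}`. [cite: StacksProject, Tag 07CP] -/
def ΨK : TK π F ι ak h g k p hp →ₐ[R] DgD π F ι ak h g k p hp :=
  IsLocalization.liftAlgHom (M := Submonoid.powers (mkK π F ι ak h g k (sPoly π F ι ak h g k p hp)))
    (f := (IsScalarTower.toAlgHom R (Dalg π F ι ak h g) (DgD π F ι ak h g k p hp)).comp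
      (KtoD π F ι ak h g k)) (isUnit_KtoD π F ι ak h g k p hp)

/-- `Ψ` extends `D_k → D → D_{s_k}`. [folklore] -/
theorem ΨK_algebraMap (d : DK π F ι ak h g k) :
    ΨK π F ι ak h g k p hp (algebraMap _ (TK π F ι ak h g k p hp) d) =
      algebraMap _ (DgD π F ι ak h g k p hp) (KtoD π F ι ak h g k d) := by
  rw [ΨK, IsLocalization.liftAlgHom_apply, IsLocalization.lift_eq]
  rfl

include h4 hh hg h5 hR in
/-- All relations of `D` die in `T_k`. [cite: StacksProject, Tag 07CP] -/
theorem algebraMap_mkK_eq_zero_of_mem {a : MvPolynomial (W n J) R} (ha : a ∈ idealD π F ι ak h g) :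
    algebraMap (DK π F ι ak h g k) (TK π F ι ak h g k p hp) (mkK π F ι ak h g k a) = 0 := by
  have key : idealD π F ι ak h g ≤ RingHom.ker
      ((IsScalarTower.toAlgHom R (DK π F ι ak h g k) (TK π F ι ak h g k p hp)).comp
        (mkK π F ι ak h g k)) := by
    refine Ideal.span_le.mpr ?_
    rintro _ ⟨ℓ | ⟨k', ℓ⟩, rfl⟩
    · exact algebraMap_mkK_relF π F ι ak h g h4 k p hp hh hg ℓ
    · exact algebraMap_mkK_relP π F ι ak h g h4 k p hp hh hg h5 hR k' ℓ
  exact key ha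

/-- `φ : D → T_k`. [cite: StacksProject, Tag 07CP] -/
def φK : Dalg π F ι ak h g →ₐ[R] TK π F ι ak h g k p hp :=
  Ideal.Quotient.liftₐ (idealD π F ι ak h g)
    ((IsScalarTower.toAlgHom R (DK π F ι ak h g k) (TK π F ι ak h g k p hp)).comp
      (mkK π F ι ak h g k))
    fun _ ha => algebraMap_mkK_eq_zero_of_mem π F ι ak h g h4 k p hp hh hg h5 hR ha

/-- Formula for `D → T_k`. [folklore] -/
theorem φK_mk (x : MvPolynomial (W n J) R) :
    φK π F ι ak h g h4 k p hp hh hg h5 hR (Ideal.Quotient.mk _ x) =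
      algebraMap _ (TK π F ι ak h g k p hp) (mkK π F ι ak h g k x) := rfl

/-- `s_k` becomes a unit in `T_k`. [folklore] -/
theorem isUnit_φK : ∀ y : Submonoid.powers (gD π F ι ak h g k p hp),
    IsUnit (φK π F ι ak h g h4 k p hp hh hg h5 hR y) := by
  rintro ⟨_, e, rfl⟩
  rw [map_pow, gD, φK_mk]
  exact (IsLocalization.Away.algebraMap_isUnit (S := TK π F ι ak h g k p hp)
    (mkK π F ι ak h g k (sPoly π F ι ak h g k p hp))).pow e

/-- `Φ : D_{s_k} → T_k`. [cite: StacksProject, Tag 07CP] -/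
def ΦK : DgD π F ι ak h g k p hp →ₐ[R] TK π F ι ak h g k p hp :=
  IsLocalization.liftAlgHom (M := Submonoid.powers (gD π F ι ak h g k p hp))
    (f := φK π F ι ak h g h4 k p hp hh hg h5 hR) (isUnit_φK π F ι ak h g h4 k p hp hh hg h5 hR)

/-- `Φ` extends `D → T_k`. [folklore] -/
theorem ΦK_algebraMap (d : Dalg π F ι ak h g) :
    ΦK π F ι ak h g h4 k p hp hh hg h5 hR (algebraMap _ (DgD π F ι ak h g k p hp) d) =
      φK π F ι ak h g h4 k p hp hh hg h5 hR d := by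
  rw [ΦK, IsLocalization.liftAlgHom_apply, IsLocalization.lift_eq]
  rfl

/-- `Ψ ∘ Φ = id`: `D_{s_k}` is a retract of (indeed isomorphic to) `T_k` (Stacks:
"`D_𝔮 = (D_k)_{𝔮_k}`"). [cite: StacksProject, Tag 07CP] -/
theorem ΨK_comp_ΦK :
    (ΨK π F ι ak h g k p hp).comp (ΦK π F ι ak h g h4 k p hp hh hg h5 hR) = AlgHom.id R _ := by
  have key : ((ΨK π F ι ak h g k p hp).comp (ΦK π F ι ak h g h4 k p hp hh hg h5 hR)).comp
      (IsScalarTower.toAlgHom R (Dalg π F ι ak h g) (DgD π F ι ak h g k p hp)) =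
      IsScalarTower.toAlgHom R (Dalg π F ι ak h g) (DgD π F ι ak h g k p hp) := by
    refine Ideal.Quotient.algHom_ext R (AlgHom.ext fun x => ?_)
    simp only [AlgHom.comp_apply, Ideal.Quotient.mkₐ_eq_mk, IsScalarTower.coe_toAlgHom',
      ΦK_algebraMap, φK_mk, ΨK_algebraMap]
    rfl
  refine AlgHom.coe_ringHom_injective (IsLocalization.ringHom_ext
    (Submonoid.powers (gD π F ι ak h g k p hp)) ?_)
  exact congrArg AlgHom.toRingHom key

include h4 hh hg h5 hR in
/-- `D_{s_k}` is formally smooth over `R`. [cite: StacksProject, Tag 07CP] -/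
theorem formallySmooth_DgD : Algebra.FormallySmooth R (DgD π F ι ak h g k p hp) :=
  formallySmooth_of_retract (ΦK π F ι ak h g h4 k p hp hh hg h5 hR) (ΨK π F ι ak h g k p hp)
    (ΨK_comp_ΦK π F ι ak h g h4 k p hp hh hg h5 hR)

include h4 hh hg h5 hR hp in
/-- **(c) of Stacks 07CP, chartwise**: `det(∂f_{ι j}/∂x_{p i}) · a_k^{m - |E_k| + 1} ∈ H_{D/R}`.
[cite: StacksProject, Tag 07CP] -/
theorem minor_mul_pow_mem_singularIdeal :
    Ideal.Quotient.mk (idealD π F ι ak h g) (inc (minor F ι k p).det) *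
        Ideal.Quotient.mk _ (inc (ak k)) ^ (Fintype.card (Jc ι k) + 1) ∈
      singularIdeal R (Dalg π F ι ak h g) := by
  rw [← gD_eq π F ι ak h g k p hp, mem_singularIdeal_iff]
  exact (Algebra.basicOpen_subset_smoothLocus_iff (f := gD π F ι ak h g k p hp)).mpr
    (formallySmooth_DgD π F ι ak h g h4 k p hp hh hg h5 hR)

end Chart

end Stacks07CPGen

end Literature.AlgebraicGeometry.Resolution

end
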